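import Summits.BirchSwinnertonDyer.BirchSwinnertonDyer.Theorems.ManinLocalTwoThreeManinOddAtSixteenOfStubs
import HarnessLib

/-!
# Kato–Néron integrality at `2` is MONOTONE IN THE 2-ADIC SIZE OF THE REAL PERIOD — stub 6″ of `kato_shift_two` v16 recut by a
# period ratio instead of an odd isogeny (route `ManinLocalTwoThree`, cell bsd-f2-manin; crux C2 `ManinOddAtFour`
# stmt-BirchSwinnertonDyer-22967; LEAD seat p1 gen 13)

THE POINT.  `KatoFactTwoAt V f` (the body of F♯ / F-es-21♭K at one member `V` of the class of `f`) says: with the normaliser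
`ϖ·Ω(V) = Ω⁺_f`, every Euler-corrected twisted symbol sum `r·Ω⁺_f` has `s·ϖ·r ∈ ℤ̄` for some ODD `s` — i.e. the twisted values are
`2`-integral IN UNITS OF THE REAL PERIOD `Ω(V)`.  Hence it passes from `V′` to ANY isogenous globally minimal `V` whose real period is
`2`-adically NOT LARGER: if `q·Ω(V′) = m·Ω(V)` with `q` ODD and `m ∈ ℤ` (so `Ω(V) = (q/m)·Ω(V′)`), then `ϖ_V = ϖ_{V′}·q/m` and
`(s·|q|)·ϖ_V·r = ±m·(s·ϖ_{V′}·r) ∈ ℤ̄`.  p3's odd-isogeny transfer `katoFactTwoAt_of_oddIsogeny` (p699401, es S-es-g26-1) is the case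
`q, m` both odd (an odd-degree isogeny scales real periods by odd/odd, `SkinnerUrban2014.exists_int_mul_realPeriodRat_eq_of_isogeny`);
the new content is `m` EVEN: the member with the `2`-adically smallest real period inherits Kato–Néron integrality from every other member.

CONSEQUENCE FOR THE LINE (skeleton v16 → v17).  Stub 6″ `stub_katoNeronIntegralTwoGamma1OptimalAtSixteenRecut` (E-es-110 at `16 ∣ N` off
the odd-symbol-closure-neighbour locus) weakens to **stub 6⁗**: E-es-110 at `16 ∣ N` for optimal `X₁(N)`-data `(V, D₁)` admitting NO
globally minimal symbol-closure curve `V′` of the class with `q·Ω(V′) = m·Ω(V)`, `q` odd — «Kato's curve `E_K` has a `2`-adically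
LARGER real period than the `X₁(N)`-optimal curve».  The excuse set GROWS (every odd symbol-closure neighbour is a period-dominating
relative: `recutLawPeriod_of_recutLawOddNeighbour`), so 6⁗ is WEAKER than 6″, and the recut is `c`-free and `f`-intrinsic: with
`Λ_{E₁} = c₁Λ₁(f)` and `Λ_{E_K} = n·c₁·𝓛̄_f` (`n` the Néron scalar of `E₁ → E_K`) the ratio `Ω(E_K)/Ω(E₁)` does not see `c₁`.

RESULTS (sorry-free): `katoFactTwoAt_of_isIsogenous_of_realPeriod_ratio` (§1, the transfer), `exists_odd_realPeriod_ratio_of_oddIsogeny`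
(§2, odd isogenies are period-odd), `katoFactTwoAt_of_symbolClosure_of_periodRecut` (§3, the 6⁗ dispatcher over F-es-21♭K),
`recutLawPeriod_of_recutLawOddNeighbour` (§3, 6″ ⟹ 6⁗), **`maninOddAtSixteen_of_katoFact_of_levelSixteenLaws_periodRecut`** and
**`maninOddAtFour_of_katoFact_of_levelSixteenLaws_periodRecut`** (§4, the v17 composition: C2 BY NAME from {F♯, F★, hex, F-es-21♭K} and
{E-an-48, E-an-53, E-es-110-off-the-period-dominated-locus} READ AT `16 ∣ N`).

HONEST FRAMING.  CONDITIONAL reduction; the four facts are statement-only Literature readings (Kato 2004, CES 2003, Stevens 1989, Kato–Wuthrich),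
the three laws are OPEN; which blind classes the period recut excuses beyond es's half-homothety locus is a CENSUS question (Ω(E_K) vs Ω(E₁);
not decided here).  C2, Manin's conjecture, Stevens' conjecture and BSD are NOT proved by this file.  No definitions, no sorry, axioms standard.
-/

set_option autoImplicit false
-- lint-debt: the directory name repeats the summit name (sibling precedent `ManinLocalTwoThreeGammaOneKatoRoad.lean`)
set_option linter.dupNamespace false

noncomputable section

open scoped Classical MatrixGroups ModularForm
open PowerSeries CongruenceSubgroup
open WeierstrassCurve Literature.NumberTheory.EllipticCurves Literature.NumberTheory.EllipticCurves.ModularForms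
  Literature.RingTheory.FormalGroups
open Summit.BirchSwinnertonDyer.Rank1Residual.ManinAdditive
open Summit.BirchSwinnertonDyer.Rank1Residual.ManinAdditive.CuspidalKummer
open Summit.BirchSwinnertonDyer.Rank1Residual.ManinAdditive.ShimuraLedger
open Summit.BirchSwinnertonDyer.Rank1Residual.ManinAdditive.KatoCurve

namespace Summit.BirchSwinnertonDyer.BirchSwinnertonDyer.Theorems.ManinLocalTwoThree

/-! ## §1 The transfer: `KatoFactTwoAt` passes to any isogenous member with `2`-adically smaller-or-equal real period -/

/-- **Kato–Néron integrality at `2` is monotone in the `2`-adic size of the real period.**  `V, V′` globally minimal and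
isogenous, `4 ∣ N`; if `q·Ω(V′) = m·Ω(V)` with `q` ODD (`m` any integer, necessarily `≠ 0`), then `KatoFactTwoAt V′ f → KatoFactTwoAt V f`:
the newform, the Euler factors `a_ℓ` and the additivity at `2` are shared (`IsNewformOf.of_isIsogenous`, `additive_of_sq_dvd_level`), the
normaliser transports as `ϖ′ = ϖ·q/m`, and `(s·|q|)·ϖ·r = ±m·(s·ϖ′·r)` is integral with `s·|q|` odd.
[cite: Kato2004Asterisque, Thm. 12.5 (1) (p. 221) (shape of the integrality statement)] -/
theorem katoFactTwoAt_of_isIsogenous_of_realPeriod_ratio (V V' : WeierstrassCurve ℚ) [V.IsElliptic] [V.IsGloballyMinimal]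
    [V'.IsElliptic] [V'.IsGloballyMinimal] {N : ℕ} [NeZero N] (f : CuspForm (Gamma0 N) 2) (h4 : 2 ^ 2 ∣ N)
    (hiso : WeierstrassCurve.IsIsogenous V' V) (q m : ℤ) (hq : Odd q)
    (hΩ : (q : ℝ) * V'.realPeriodRat = (m : ℝ) * V.realPeriodRat)
    (hK : KatoFactTwoAt V' f) : KatoFactTwoAt V f := by
  haveI : Fact (Nat.Prime 2) := ⟨Nat.prime_two⟩
  intro hf hg hmu M _ hcop χ hprim h1 hord h8 ϖ r hϖ hr
  -- the newform and the additivity are shared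
  have hf' : IsNewformOf V' f := hf.of_isIsogenous hiso
  obtain ⟨hg', hmu'⟩ := additive_of_sq_dvd_level 2 V' f hf' h4
  -- the Euler factors are shared: `a_ℓ(V') = a_ℓ(f) = a_ℓ(V)`
  have hL : ∀ ℓ : ℕ, ((V'.LFunction ℓ : ℤ) : ℂ) = ((V.LFunction ℓ : ℤ) : ℂ) := fun ℓ ↦ by
    rw [← hf'.2 ℓ, hf.2 ℓ]
  -- `m ≠ 0`: the real period of `V'` is positive and `q ≠ 0`
  have hq0 : q ≠ 0 := by rintro rfl; exact (Int.not_even_iff_odd.mpr hq) (Even.zero)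
  have hΩ'pos : 0 < V'.realPeriodRat := KatoCurve.realPeriodRat_pos V'
  have hΩpos : 0 < V.realPeriodRat := KatoCurve.realPeriodRat_pos V
  have hm0 : m ≠ 0 := by
    rintro rfl
    have : (q : ℝ) * V'.realPeriodRat = 0 := by rw [hΩ]; push_cast; ring
    rcases mul_eq_zero.mp this with h | h
    · exact hq0 (by exact_mod_cast h)
    · exact hΩ'pos.ne' h
  -- the transported normaliser `ϖ' = ϖ q / m`
  set ϖ' : ℚ := ϖ * q / m with hϖ'def
  have hϖ' : (ϖ' : ℝ) * V'.realPeriodRat = plusPeriod f := by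
    have hm0R : (m : ℝ) ≠ 0 := by exact_mod_cast hm0
    have e : (ϖ' : ℝ) * V'.realPeriodRat = (ϖ : ℝ) * ((q : ℝ) * V'.realPeriodRat) / m := by
      rw [hϖ'def]; push_cast; field_simp
    rw [e, hΩ, ← hϖ]
    field_simp
  -- the Euler-corrected sum hypothesis, read at `V'`
  have hr' : (∏ ℓ ∈ N.primeFactors with ¬ ℓ ^ 2 ∣ N,
      (((ℓ : ℂ) - (V'.LFunction ℓ : ℂ) * χ (ℓ : ZMod M)) *
        ((ℓ : ℂ) - (V'.LFunction ℓ : ℂ) * (χ (ℓ : ZMod M))⁻¹))) * twistedSymbolSum f χ =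
      r * (plusPeriod f : ℂ) := by
    simp_rw [hL]; exact hr
  obtain ⟨s', hs'odd, hint⟩ := hK hf' hg' hmu' M hcop χ hprim h1 hord h8 ϖ' r hϖ' hr'
  -- undo the transport: `m · (s' ϖ' r) = s' q ϖ r`, and `|q|` is odd
  have hqodd : Odd q.natAbs := Int.natAbs_odd.mpr hq
  refine ⟨s' * q.natAbs, ?_, ?_⟩
  · intro h
    rcases (Nat.prime_two.dvd_mul.mp h) with h | h
    · exact hs'odd h
    · exact (Nat.not_even_iff_odd.mpr hqodd) (even_iff_two_dvd.mpr h)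
  · have hm0C : (m : ℂ) ≠ 0 := by exact_mod_cast hm0
    have key : ((s' : ℂ) * (ϖ' : ℂ) * r) * (m : ℂ) = (s' : ℂ) * (q : ℂ) * (ϖ : ℂ) * r := by
      rw [hϖ'def]; push_cast; field_simp
    have hmZ : IsIntegral ℤ (m : ℂ) := by
      simpa using (isIntegral_algebraMap : IsIntegral ℤ (algebraMap ℤ ℂ m))
    have hint' : IsIntegral ℤ ((s' : ℂ) * (q : ℂ) * (ϖ : ℂ) * r) := by
      rw [← key]; exact hint.mul hmZ
    have e : ((s' * q.natAbs : ℕ) : ℂ) * (ϖ : ℂ) * r = (s' : ℂ) * ((q.natAbs : ℕ) : ℂ) * (ϖ : ℂ) * r := by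
      push_cast; ring
    rw [e]
    have hcast : ((q.natAbs : ℕ) : ℂ) = (((q.natAbs : ℕ) : ℤ) : ℂ) := (Int.cast_natCast _).symm
    rw [hcast]
    rcases le_or_gt 0 q with hq' | hq'
    · rw [Int.natAbs_of_nonneg hq']; exact hint'
    · rw [Int.ofNat_natAbs_of_nonpos hq'.le, Int.cast_neg]
      convert hint'.neg using 1; ring

/-! ## §2 Odd-degree isogenies are period-odd (the case p3's transfer covers) -/

/-- **An ODD-degree isogeny scales real periods by odd/odd**: for globally minimal `V′, V` in the class of a newform `f` and
`ψ : V′ → V` of odd degree, `q·Ω(V′) = a·Ω(V)` with `q` and `a` ODD (`SkinnerUrban2014.exists_int_mul_realPeriodRat_eq_of_isogeny`: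
`q ∣ deg ψ`, `ab = deg ψ`).  (`IsNewformOf V f` only supplies the period data the Skinner–Urban lemma is stated over.)
[cite: SilvermanAEC2009, Thm. VI.4.1(b) (periods under isogeny; shape only)] -/
theorem exists_odd_realPeriod_ratio_of_oddIsogeny (V V' : WeierstrassCurve ℚ) [V.IsElliptic] [V.IsGloballyMinimal]
    [V'.IsElliptic] [V'.IsGloballyMinimal] {N : ℕ} [NeZero N] (f : CuspForm (Gamma0 N) 2) (hf : IsNewformOf V f)
    (ψ : Isogeny V' V) (hodd : Odd ψ.degree) :
    ∃ q a : ℤ, Odd q ∧ Odd a ∧ (q : ℝ) * V'.realPeriodRat = (a : ℝ) * V.realPeriodRat := by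
  have hiso : WeierstrassCurve.IsIsogenous V' V := ⟨ψ⟩
  have hf' : IsNewformOf V' f := hf.of_isIsogenous hiso
  obtain ⟨D⟩ := Literature.NumberTheory.Automorphic.nonempty_modularParametrizationData_of_isNewformOf hf
  obtain ⟨D'⟩ := Literature.NumberTheory.Automorphic.nonempty_modularParametrizationData_of_isNewformOf hf'
  obtain ⟨q, a, b, hq0, hqd, hab, hqa⟩ := SkinnerUrban2014.exists_int_mul_realPeriodRat_eq_of_isogeny D' D ψ
  have hd0 : (ψ.degree : ℤ) ≠ 0 := by exact_mod_cast (Isogeny.degree_pos ψ).ne'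
  have hqodd : Odd q.natAbs := by
    refine Odd.of_dvd_nat hodd ?_
    exact Int.natAbs_dvd_natAbs.mpr hqd |>.trans (by simp)
  have haodd : Odd a.natAbs := by
    refine Odd.of_dvd_nat hodd ?_
    have : a ∣ (ψ.degree : ℤ) := ⟨b, hab.symm⟩
    exact Int.natAbs_dvd_natAbs.mpr this |>.trans (by simp)
  exact ⟨q, a, Int.natAbs_odd.mp hqodd, Int.natAbs_odd.mp haodd, hqa⟩

/-! ## §3 Stub 6″ recut by the period ratio (6⁗), over F-es-21♭K -/

/-- **The 6⁗ dispatcher**: `KatoFactTwoAt` at an optimal `X₁(N)`-curve `V` (`4 ∣ N`) from F-es-21♭K whenever SOME globally minimal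
symbol-closure curve `V′` of the class has `q·Ω(V′) = m·Ω(V)` with `q` odd (Kato's curve then dominates `V` `2`-adically), and from
the RECUT LAW otherwise. [cite: Kato2004Asterisque, (8.1.3) (p. 180) and Thm. 12.5 (1) (p. 221) (shape of F-es-21♭K)] -/
theorem katoFactTwoAt_of_symbolClosure_of_periodRecut (hK : kato_isIntegral_twistedSymbolSum_two_symbolClosure)
    {N : ℕ} [NeZero N] (h4 : 2 ^ 2 ∣ N)
    (V : WeierstrassCurve ℚ) [V.IsElliptic] [V.IsGloballyMinimal] (D₁ : Gamma1ParametrizationData V N)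
    (hrecut : (¬ ∃ (V' : WeierstrassCurve ℚ) (_ : V'.IsElliptic) (_ : V'.IsGloballyMinimal) (q m : ℤ),
        Odd q ∧ WeierstrassCurve.IsIsogenous V' V ∧ (q : ℝ) * V'.realPeriodRat = (m : ℝ) * V.realPeriodRat ∧
        IsSymbolClosureCurve V' D₁.f) → KatoFactTwoAt V D₁.f) :
    KatoFactTwoAt V D₁.f := by
  by_cases h : ∃ (V' : WeierstrassCurve ℚ) (_ : V'.IsElliptic) (_ : V'.IsGloballyMinimal) (q m : ℤ),
      Odd q ∧ WeierstrassCurve.IsIsogenous V' V ∧ (q : ℝ) * V'.realPeriodRat = (m : ℝ) * V.realPeriodRat ∧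
      IsSymbolClosureCurve V' D₁.f
  · obtain ⟨V', _, _, q, m, hq, hiso, hΩ, hsc⟩ := h
    exact katoFactTwoAt_of_isIsogenous_of_realPeriod_ratio V V' D₁.f h4 hiso q m hq hΩ (hK V' D₁.f hsc)
  · exact hrecut h

/-- **Every odd symbol-closure neighbour is a period-dominating symbol-closure relative** (§2), so the excuse set of 6⁗ contains that
of 6″. [cite: SilvermanAEC2009, Thm. VI.4.1(b) (shape only)] -/
theorem exists_periodDominating_of_oddSymbolClosureNeighbour
    (V : WeierstrassCurve ℚ) [V.IsElliptic] [V.IsGloballyMinimal] {N : ℕ} [NeZero N]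
    (D₁ : Gamma1ParametrizationData V N)
    (h : ∃ (V' : WeierstrassCurve ℚ) (_ : V'.IsElliptic) (_ : V'.IsGloballyMinimal) (ψ : Isogeny V' V),
      Odd ψ.degree ∧ IsSymbolClosureCurve V' D₁.f) :
    ∃ (V' : WeierstrassCurve ℚ) (_ : V'.IsElliptic) (_ : V'.IsGloballyMinimal) (q m : ℤ),
      Odd q ∧ WeierstrassCurve.IsIsogenous V' V ∧ (q : ℝ) * V'.realPeriodRat = (m : ℝ) * V.realPeriodRat ∧
      IsSymbolClosureCurve V' D₁.f := by
  obtain ⟨V', _, _, ψ, hodd, hsc⟩ := h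
  obtain ⟨q, a, hq, -, hqa⟩ := exists_odd_realPeriod_ratio_of_oddIsogeny V V' D₁.f D₁.isNewformOf ψ hodd
  exact ⟨V', inferInstance, inferInstance, q, a, hq, ⟨ψ⟩, hqa, hsc⟩

/-- **6″ ⟹ 6⁗** (the period recut is WEAKER than the odd-neighbour recut of v16): if E-es-110 is assumed at `16 ∣ N` off the
odd-symbol-closure-neighbour locus, it holds at `16 ∣ N` off the period-dominated locus. [folklore] -/
theorem recutLawPeriod_of_recutLawOddNeighbour
    (h110 : ∀ (V : WeierstrassCurve ℚ) [V.IsElliptic] [V.IsGloballyMinimal] {N : ℕ} [NeZero N]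
      (D₁ : Gamma1ParametrizationData V N), D₁.IsOptimal → 2 ^ 4 ∣ N →
      (¬ ∃ (V' : WeierstrassCurve ℚ) (_ : V'.IsElliptic) (_ : V'.IsGloballyMinimal) (ψ : Isogeny V' V),
        Odd ψ.degree ∧ IsSymbolClosureCurve V' D₁.f) → KatoFactTwoAt V D₁.f) :
    ∀ (V : WeierstrassCurve ℚ) [V.IsElliptic] [V.IsGloballyMinimal] {N : ℕ} [NeZero N]
      (D₁ : Gamma1ParametrizationData V N), D₁.IsOptimal → 2 ^ 4 ∣ N →
      (¬ ∃ (V' : WeierstrassCurve ℚ) (_ : V'.IsElliptic) (_ : V'.IsGloballyMinimal) (q m : ℤ),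
        Odd q ∧ WeierstrassCurve.IsIsogenous V' V ∧ (q : ℝ) * V'.realPeriodRat = (m : ℝ) * V.realPeriodRat ∧
        IsSymbolClosureCurve V' D₁.f) → KatoFactTwoAt V D₁.f := by
  intro V _ _ N _ D₁ hopt h16 hno
  exact h110 V D₁ hopt h16 fun h => hno (exists_periodDominating_of_oddSymbolClosureNeighbour V D₁ h)

/-! ## §4 The v17 composition: C2 BY NAME with stub 6⁗ -/

/-- **`ManinOddAtSixteen` ⟸ F♯ ∧ F★ ∧ hex ∧ F-es-21♭K ∧ (E-an-48, E-an-53, E-es-110-off-the-period-dominated-locus READ AT `16 ∣ N`)** —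
the composition of skeleton v17 of `kato_shift_two` up to p2's glue (the level-wise theorem `not_two_dvd_maninConstant_of_katoFact_of_levelLaws`
fed through the 6⁗ dispatcher).  CONDITIONAL reduction; nothing about BSD, Manin's or Stevens' conjecture is proved.
[cite: Kato2004Asterisque, Thm. 9.7 (p. 189) and Thm. 12.5 (1) (p. 221)] [cite: ConradEdixhovenStein2003, §6.1.2 and §6.2] [cite: Stevens1989, §2] -/
theorem maninOddAtSixteen_of_katoFact_of_levelSixteenLaws_periodRecut
    (hF : kato_neron_isIntegral_twistedSymbolSum_of_additive_two_real)
    (hFstar : optimalGamma1Parametrization_cusp_rational) (hex : exists_optimal_gamma1ParametrizationData)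
    (hK : kato_isIntegral_twistedSymbolSum_two_symbolClosure)
    (h48 : ∀ (W : WeierstrassCurve ℚ) [W.IsElliptic] [W.IsGloballyMinimal] {N : ℕ} [NeZero N]
      (D : ModularParametrizationData W N) (a : ℕ → ℤ), (∀ n, (a n : ℂ) = cuspCoeff D.f n) →
      2 ^ 4 ∣ N → (∀ z ∈ D.L.lattice, ∃ w ∈ periodLattice D.f, z = D.c * w) →
      ∀ e : ℚ, W.twoTorsionPolynomial.toPoly.IsRoot e →
      ∀ z : ℚ⟦X⟧, IsParamGerm W D.c a z →
      ∃ (r : ℕ → ℤ) (g A B : ℤ⟦X⟧), IsCuspidalKummerRep N (kummerSeries W D.c e z) r g A B)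
    (h53 : ∀ (W : WeierstrassCurve ℚ) [W.IsElliptic] [W.IsGloballyMinimal] {N : ℕ} [NeZero N]
      (D : ModularParametrizationData W N) (a : ℕ → ℤ), (∀ n, (a n : ℂ) = cuspCoeff D.f n) →
      2 ^ 4 ∣ N → (∀ z ∈ D.L.lattice, ∃ w ∈ periodLattice D.f, z = D.c * w) →
      ∀ (a₂ a₄ e : ℤ), W.a₁ = 0 → W.a₃ = 0 → W.a₂ = a₂ → W.a₄ = a₄ →
      W.twoTorsionPolynomial.toPoly.IsRoot (e : ℚ) → ¬ KummerBlindAtTwo a₂ a₄ e →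
      ∀ z : ℚ⟦X⟧, IsParamGerm W D.c a z →
      ∀ (r : ℕ → ℤ) (g A B : ℤ⟦X⟧), IsCuspidalKummerRep N (kummerSeries W D.c ((e : ℚ)) z) r g A B →
      ∃ δ ∈ N.divisors, Odd (r δ))
    (h110 : ∀ (V : WeierstrassCurve ℚ) [V.IsElliptic] [V.IsGloballyMinimal] {N : ℕ} [NeZero N]
      (D₁ : Gamma1ParametrizationData V N), D₁.IsOptimal → 2 ^ 4 ∣ N →
      (¬ ∃ (V' : WeierstrassCurve ℚ) (_ : V'.IsElliptic) (_ : V'.IsGloballyMinimal) (q m : ℤ),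
        Odd q ∧ WeierstrassCurve.IsIsogenous V' V ∧ (q : ℝ) * V'.realPeriodRat = (m : ℝ) * V.realPeriodRat ∧
        IsSymbolClosureCurve V' D₁.f) → KatoFactTwoAt V D₁.f) :
    ManinOddAtSixteen := by
  intro _hMz _hAU _hCs _hnf W _ _ N _ D hopt h16
  have h4 : 2 ^ 2 ∣ N := dvd_trans ⟨4, by norm_num⟩ h16
  exact not_two_dvd_maninConstant_of_katoFact_of_levelLaws hF hFstar hex h4
    (fun V _ _ D' a ha hopt' => h48 V D' a ha h16 hopt')
    (fun V _ _ D' a ha hopt' => h53 V D' a ha h16 hopt')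
    (fun V _ _ D₁ hD₁ => katoFactTwoAt_of_symbolClosure_of_periodRecut hK h4 V D₁ (h110 V D₁ hD₁ h16)) W D hopt

/-- **THE ROUTE DECL `Theses.ManinLocalTwoThree.ManinOddAtFour` BY NAME from the seven inputs of skeleton v17** (stub 6⁗ = E-es-110 at
`16 ∣ N` off the period-dominated locus), through p2's print-free `maninOddAtFour_of_maninOddAtSixteen'`.  CONDITIONAL reduction = the
composition `ManinOddAtFour_of` of skeleton v17; C2, Manin's conjecture and BSD are NOT proved.
[cite: Kato2004Asterisque, Thm. 9.7 (p. 189) and Thm. 12.5 (1) (p. 221)] [cite: ConradEdixhovenStein2003, §6.1.2 and §6.2] [cite: Stevens1989, §2] -/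
theorem maninOddAtFour_of_katoFact_of_levelSixteenLaws_periodRecut
    (hF : kato_neron_isIntegral_twistedSymbolSum_of_additive_two_real)
    (hFstar : optimalGamma1Parametrization_cusp_rational) (hex : exists_optimal_gamma1ParametrizationData)
    (hK : kato_isIntegral_twistedSymbolSum_two_symbolClosure)
    (h48 : ∀ (W : WeierstrassCurve ℚ) [W.IsElliptic] [W.IsGloballyMinimal] {N : ℕ} [NeZero N]
      (D : ModularParametrizationData W N) (a : ℕ → ℤ), (∀ n, (a n : ℂ) = cuspCoeff D.f n) →
      2 ^ 4 ∣ N → (∀ z ∈ D.L.lattice, ∃ w ∈ periodLattice D.f, z = D.c * w) →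
      ∀ e : ℚ, W.twoTorsionPolynomial.toPoly.IsRoot e →
      ∀ z : ℚ⟦X⟧, IsParamGerm W D.c a z →
      ∃ (r : ℕ → ℤ) (g A B : ℤ⟦X⟧), IsCuspidalKummerRep N (kummerSeries W D.c e z) r g A B)
    (h53 : ∀ (W : WeierstrassCurve ℚ) [W.IsElliptic] [W.IsGloballyMinimal] {N : ℕ} [NeZero N]
      (D : ModularParametrizationData W N) (a : ℕ → ℤ), (∀ n, (a n : ℂ) = cuspCoeff D.f n) →
      2 ^ 4 ∣ N → (∀ z ∈ D.L.lattice, ∃ w ∈ periodLattice D.f, z = D.c * w) →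
      ∀ (a₂ a₄ e : ℤ), W.a₁ = 0 → W.a₃ = 0 → W.a₂ = a₂ → W.a₄ = a₄ →
      W.twoTorsionPolynomial.toPoly.IsRoot (e : ℚ) → ¬ KummerBlindAtTwo a₂ a₄ e →
      ∀ z : ℚ⟦X⟧, IsParamGerm W D.c a z →
      ∀ (r : ℕ → ℤ) (g A B : ℤ⟦X⟧), IsCuspidalKummerRep N (kummerSeries W D.c ((e : ℚ)) z) r g A B →
      ∃ δ ∈ N.divisors, Odd (r δ))
    (h110 : ∀ (V : WeierstrassCurve ℚ) [V.IsElliptic] [V.IsGloballyMinimal] {N : ℕ} [NeZero N]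
      (D₁ : Gamma1ParametrizationData V N), D₁.IsOptimal → 2 ^ 4 ∣ N →
      (¬ ∃ (V' : WeierstrassCurve ℚ) (_ : V'.IsElliptic) (_ : V'.IsGloballyMinimal) (q m : ℤ),
        Odd q ∧ WeierstrassCurve.IsIsogenous V' V ∧ (q : ℝ) * V'.realPeriodRat = (m : ℝ) * V.realPeriodRat ∧
        IsSymbolClosureCurve V' D₁.f) → KatoFactTwoAt V D₁.f) :
    Summit.BirchSwinnertonDyer.BirchSwinnertonDyer.Theses.ManinLocalTwoThree.ManinOddAtFour :=
  maninOddAtFour_of_maninOddAtSixteen'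
    (maninOddAtSixteen_of_katoFact_of_levelSixteenLaws_periodRecut hF hFstar hex hK h48 h53 h110)

end Summit.BirchSwinnertonDyer.BirchSwinnertonDyer.Theorems.ManinLocalTwoThree

end
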